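import Summits.RiemannHypothesis.RiemannHypothesis.Theorems.PfPersistenceAutocorrCeiling
import Summits.RiemannHypothesis.RiemannHypothesis.Theorems.PfPersistenceLadderSharp
import HarnessLib

/-!
# PF-persistence cell — THE UNIVERSAL AUTOCORRELATION CEILING IS A MAXIMUM (sharpness of 9bb50f3e143f)

Framing (page 1): mechanism/rigidity campaign; no RH claims.  Every `theorem` below is PROVED (kernel-checked,
RH-free, weight-free, window-free: facts about continuous real functions on an interval); nothing asserts a
premiss for `ζ` at any window and no NUMBER for `ζ` is asserted here.

`PfPersistenceAutocorrCeiling` (9bb50f3e143f) proves `|∫_0^{T-y} f(t)f(t+y)dt| ≤ cos(π/(⌈T/y⌉₊+1))·∫_0^T f²` for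
every continuous `f` and `0 < y < T`.  THIS FILE proves the constant is OPTIMAL AND ATTAINED at every `(T, y)`: a
DISJOINT BUMP TRAIN — `M = ⌈T/y⌉₊` copies of one continuous hat bump of width `≤ min(y, T − (M−1)y)` at mutual
distance `y` inside `(0, T)`, with the Perron amplitudes `sin((k+1)π/(M+1))` of the path graph `P_M` (`chain_tight`,
d0076f571175) — gives `∫_0^{T-y} f f(·+y) = cos(π/(M+1))·∫_0^T f²`, `∫_0^T f² > 0`, `f ≥ 0`; alternating amplitudes
give `−cos(π/(M+1))`.  §1 bump-train identities and bookkeeping (general bump, general amplitudes); §2 attainment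
(band form `(n+1)y < T`, sharp `⌈T/y⌉₊` form, both signs); §3 OPTIMALITY (`|·| ≤ c·∫f²` for all continuous `f` iff
`cos(π/(⌈T/y⌉₊+1)) ≤ c`); §4 the window form on `[−L/2, L/2]`.
ERRATUM (words only): the informal REMARK in the header of 9bb50f3e143f calls the ceiling "never attained" — WRONG
for continuous `f`, superseded by §2 (attained by bump trains).  Nothing is claimed about finite-dimensional
trigonometric Galerkin spaces (DATA elsewhere), nor about the constrained supremum over ONE-SIGNED ODD half-window
profiles of the near-lag ladder (186f1e2d346c; RULING A376 (1) P1: OPEN) — note only that the maximiser here is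
itself nonnegative.
-/

set_option linter.dupNamespace false
set_option linter.style.longLine false

noncomputable section

namespace Summit.RiemannHypothesis.RiemannHypothesis.Theorems.PfPersistence

open Real intervalIntegral MeasureTheory Finset

/-! ## §1 Disjoint bump trains -/

/-- PROVED: two copies of a bump vanishing off `(0, w)`, placed at distinct multiples of `y ≥ w`, have disjoint
supports: their product vanishes identically. [folklore] -/
theorem bump_shift_mul_eq_zero {β : ℝ → ℝ} {w y : ℝ} (hβ : ∀ u, u ∉ Set.Ioo 0 w → β u = 0) (hwy : w ≤ y)
    (t : ℝ) {j k : ℕ} (hjk : j ≠ k) : β (t - j * y) * β (t - k * y) = 0 := by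
  by_contra h
  have hj : β (t - j * y) ≠ 0 := fun h0 => h (by rw [h0, zero_mul])
  have hk : β (t - k * y) ≠ 0 := fun h0 => h (by rw [h0, mul_zero])
  have ⟨hj1, hj2⟩ : t - j * y ∈ Set.Ioo 0 w := by by_contra hc; exact hj (hβ _ hc)
  have ⟨hk1, hk2⟩ : t - k * y ∈ Set.Ioo 0 w := by by_contra hc; exact hk (hβ _ hc)
  have hy : 0 ≤ y := le_trans (by linarith) hwy
  rcases lt_or_gt_of_ne hjk with hlt | hlt
  · have h1 : ((j:ℝ) + 1) * y ≤ (k:ℝ) * y :=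
      mul_le_mul_of_nonneg_right (by exact_mod_cast hlt) hy
    linarith
  · have h1 : ((k:ℝ) + 1) * y ≤ (j:ℝ) * y :=
      mul_le_mul_of_nonneg_right (by exact_mod_cast hlt) hy
    linarith

/-- PROVED: the SQUARE of a disjoint bump train is the train of squares, `(Σ x_k β_k)² = Σ x_k² β_k²`. [folklore] -/
theorem bumpTrain_sq {β : ℝ → ℝ} {w y : ℝ} (hβ : ∀ u, u ∉ Set.Ioo 0 w → β u = 0) (hwy : w ≤ y)
    (x : ℕ → ℝ) (M : ℕ) (t : ℝ) :
    (∑ k ∈ range M, x k * β (t - k * y)) ^ 2 = ∑ k ∈ range M, x k ^ 2 * β (t - k * y) ^ 2 := by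
  rw [sq, Finset.sum_mul_sum]
  refine Finset.sum_congr rfl fun j hj => ?_
  rw [Finset.sum_eq_single j]
  · ring
  · intro k _ hkj
    have h0 := bump_shift_mul_eq_zero hβ hwy t (show j ≠ k from fun h => hkj h.symm)
    calc x j * β (t - j * y) * (x k * β (t - k * y))
        = x j * x k * (β (t - j * y) * β (t - k * y)) := by ring
      _ = 0 := by rw [h0, mul_zero]
  · exact fun hj' => absurd hj hj'

/-- PROVED: the SHIFTED PRODUCT of a disjoint bump train with `n+2` bumps is the train of squares with the
path-graph products as amplitudes, `F(t)·F(t+y) = Σ_{k≤n} x_k x_{k+1} β_k(t)²`. [folklore] -/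
theorem bumpTrain_mul_shift {β : ℝ → ℝ} {w y : ℝ} (hβ : ∀ u, u ∉ Set.Ioo 0 w → β u = 0) (hwy : w ≤ y)
    (x : ℕ → ℝ) (n : ℕ) (t : ℝ) :
    (∑ k ∈ range (n + 2), x k * β (t - k * y)) * (∑ j ∈ range (n + 2), x j * β (t + y - j * y))
      = ∑ k ∈ range (n + 1), x k * x (k + 1) * β (t - k * y) ^ 2 := by
  rw [Finset.sum_mul_sum]
  have hinner : ∀ k ∈ range (n + 2),
      ∑ j ∈ range (n + 2), x k * β (t - k * y) * (x j * β (t + y - j * y))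
        = if k + 1 ∈ range (n + 2) then x k * x (k + 1) * β (t - k * y) ^ 2 else 0 := by
    intro k _
    rw [← Finset.sum_ite_eq' (range (n + 2)) (k + 1) (fun _ => x k * x (k + 1) * β (t - k * y) ^ 2)]
    refine Finset.sum_congr rfl fun j _ => ?_
    by_cases hjk : j = k + 1
    · subst hjk
      rw [if_pos rfl]
      have e : t + y - (((k + 1 : ℕ)):ℝ) * y = t - k * y := by push_cast; ring
      rw [e]; ring
    · rw [if_neg hjk]
      have h0 := bump_shift_mul_eq_zero hβ hwy (t + y) (show k + 1 ≠ j from fun h => hjk h.symm)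
      have e : t + y - (((k + 1 : ℕ)):ℝ) * y = t - k * y := by push_cast; ring
      rw [e] at h0
      calc x k * β (t - k * y) * (x j * β (t + y - j * y))
          = x k * x j * (β (t - k * y) * β (t + y - j * y)) := by ring
        _ = 0 := by rw [h0, mul_zero]
  rw [Finset.sum_congr rfl hinner, Finset.sum_range_succ]
  have hlast : ¬ (n + 1 + 1 ∈ range (n + 2)) := by simp
  rw [if_neg hlast, add_zero]
  refine Finset.sum_congr rfl fun k hk => ?_
  have hk' : k + 1 ∈ range (n + 2) := by
    have := Finset.mem_range.mp hk
    exact Finset.mem_range.mpr (by omega)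
  rw [if_pos hk']

/-- PROVED: a train of `m` squared bumps (distance `y ≥ 0`, width `w`) lives in `(0, S]` once `(m−1)y + w ≤ S`. [folklore] -/
theorem bumpTrain_support_subset {β : ℝ → ℝ} {w y : ℝ} (hβ : ∀ u, u ∉ Set.Ioo 0 w → β u = 0) (hy : 0 ≤ y)
    (c : ℕ → ℝ) (m : ℕ) {S : ℝ} (hS : ((m:ℝ) - 1) * y + w ≤ S) :
    Function.support (fun t => ∑ k ∈ range m, c k * β (t - k * y) ^ 2) ⊆ Set.Ioc 0 S := by
  intro t ht
  rw [Function.mem_support] at ht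
  obtain ⟨k, hk, hne⟩ := Finset.exists_ne_zero_of_sum_ne_zero ht
  have hβne : β (t - k * y) ≠ 0 := by
    intro h0; apply hne; rw [h0]; ring
  have hmem : t - k * y ∈ Set.Ioo 0 w := by by_contra hc; exact hβne (hβ _ hc)
  obtain ⟨h1, h2⟩ := hmem
  have hk' : (k:ℝ) + 1 ≤ (m:ℝ) := by exact_mod_cast Finset.mem_range.mp hk
  have hky : (0:ℝ) ≤ k * y := mul_nonneg (Nat.cast_nonneg k) hy
  have hkm : (k:ℝ) * y ≤ ((m:ℝ) - 1) * y := mul_le_mul_of_nonneg_right (by linarith) hy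
  exact ⟨by linarith, by linarith⟩

/-- PROVED: the full-line integral of a train of squared bumps is `(Σ c_k)·∫β²` (translation invariance). [folklore] -/
theorem integral_bumpTrain_sq_sum {β : ℝ → ℝ} (hβi : Integrable (fun u => β u ^ 2)) (c : ℕ → ℝ) (m : ℕ)
    (y : ℝ) :
    ∫ t, ∑ k ∈ range m, c k * β (t - k * y) ^ 2 = (∑ k ∈ range m, c k) * ∫ u, β u ^ 2 := by
  rw [MeasureTheory.integral_finsetSum]
  · rw [Finset.sum_mul]
    refine Finset.sum_congr rfl fun k _ => ?_
    rw [MeasureTheory.integral_const_mul]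
    have h := integral_sub_right_eq_self (μ := (volume : Measure ℝ)) (fun u => β u ^ 2) ((k:ℝ) * y)
    rw [h]
  · intro k _
    exact (hβi.comp_sub_right ((k:ℝ) * y)).const_mul (c k)

/-- PROVED — THE HAT BUMP: for every `w` there is a continuous, nonnegative function vanishing off `(0, w)` and
positive on `(0, w)` (namely `u ↦ max 0 (min u (w − u))`). [folklore] -/
theorem exists_hat_bump (w : ℝ) :
    ∃ β : ℝ → ℝ, Continuous β ∧ (∀ u, 0 ≤ β u) ∧ (∀ u, u ∉ Set.Ioo 0 w → β u = 0) ∧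
      (∀ u ∈ Set.Ioo 0 w, 0 < β u) := by
  refine ⟨fun u => max 0 (min u (w - u)),
    continuous_const.max (continuous_id.min (continuous_const.sub continuous_id)),
    fun u => le_max_left _ _, fun u hu => ?_, fun u hu => ?_⟩
  · refine max_eq_left ?_
    by_contra hc
    push Not at hc
    have h1 : 0 < u := lt_of_lt_of_le hc (min_le_left _ _)
    have h2 : 0 < w - u := lt_of_lt_of_le hc (min_le_right _ _)
    exact hu ⟨h1, by linarith⟩
  · obtain ⟨h1, h2⟩ := hu
    exact lt_max_of_lt_right (lt_min h1 (by linarith))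

/-! ## §2 Attainment: the ceiling is a maximum -/

/-- **PROVED — THE BUMP-TRAIN INTEGRALS:** for `0 < y`, `(n+1)y < T` and ANY amplitudes `x_0, …, x_{n+1}` there
is a continuous `f` vanishing off `(0, T)` (a train of `n+2` disjoint hat bumps at mutual distance `y`, bump
energy `B > 0`) with `∫_0^T f² = (Σ_{k≤n+1} x_k²)·B` and `∫_0^{T-y} f f(·+y) = (Σ_{k≤n} x_k x_{k+1})·B`; it is
nonnegative when the amplitudes are.  The continuum shifted correlation thus realises every path-graph Rayleigh
quotient. [folklore] -/
theorem exists_bumpTrain_integrals {y T : ℝ} (hy : 0 < y) (n : ℕ) (hT : ((n:ℝ) + 1) * y < T) (x : ℕ → ℝ) :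
    ∃ f : ℝ → ℝ, Continuous f ∧ (∀ t, t ∉ Set.Ioo 0 T → f t = 0) ∧
      ((∀ k, k ≤ n + 1 → 0 ≤ x k) → ∀ t, 0 ≤ f t) ∧
      ∃ B : ℝ, 0 < B ∧
        (∫ t in (0:ℝ)..T, f t ^ 2 = (∑ k ∈ range (n + 2), x k ^ 2) * B) ∧
        (∫ t in (0:ℝ)..(T - y), f t * f (t + y) = (∑ k ∈ range (n + 1), x k * x (k + 1)) * B) := by
  -- bump width: fits the lag and the slack
  set w : ℝ := min y (T - ((n:ℝ) + 1) * y) with hw_def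
  have hw0 : 0 < w := lt_min hy (by linarith)
  have hwy : w ≤ y := min_le_left _ _
  have hwT : ((n:ℝ) + 1) * y + w ≤ T := by
    have := min_le_right y (T - ((n:ℝ) + 1) * y); linarith
  -- the bump and its energy
  obtain ⟨β, hβc, hβnn, hβ0, hβpos⟩ := exists_hat_bump w
  have hβK : HasCompactSupport (fun u => β u ^ 2) := by
    refine HasCompactSupport.intro (isCompact_Icc (a := (0:ℝ)) (b := w)) fun u hu => ?_
    have h0 : β u = 0 := hβ0 u (fun h => hu (Set.Ioo_subset_Icc_self h))
    simp [h0]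
  have hβi : Integrable (fun u => β u ^ 2) := (hβc.pow 2).integrable_of_hasCompactSupport hβK
  have hB : 0 < ∫ u, β u ^ 2 := by
    have hsupp : Function.support (fun u => β u ^ 2) ⊆ Set.Ioc 0 w := by
      intro u hu
      rw [Function.mem_support] at hu
      have hne : β u ≠ 0 := fun h => hu (by simp [h])
      have hmem : u ∈ Set.Ioo 0 w := by by_contra hc; exact hne (hβ0 u hc)
      exact ⟨hmem.1, hmem.2.le⟩
    rw [← intervalIntegral.integral_eq_integral_of_support_subset hsupp]
    exact intervalIntegral.intervalIntegral_pos_of_pos_on ((hβc.pow 2).intervalIntegrable _ _)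
      (fun u hu => pow_pos (hβpos u hu) 2) hw0
  -- the train
  refine ⟨fun t => ∑ k ∈ range (n + 2), x k * β (t - k * y), ?_, ?_, ?_, ∫ u, β u ^ 2, hB, ?_, ?_⟩
  · exact continuous_finsetSum _ fun k _ => continuous_const.mul (hβc.comp (continuous_id.sub continuous_const))
  · intro t ht
    refine Finset.sum_eq_zero fun k hk => ?_
    have hk' : (k:ℝ) ≤ (n:ℝ) + 1 := by
      have := Finset.mem_range.mp hk
      exact_mod_cast (show k ≤ n + 1 by omega)
    by_cases hmem : t - k * y ∈ Set.Ioo 0 w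
    · exfalso
      obtain ⟨h1, h2⟩ := hmem
      have hky : (0:ℝ) ≤ k * y := mul_nonneg (Nat.cast_nonneg k) hy.le
      have hkn : (k:ℝ) * y ≤ ((n:ℝ) + 1) * y := mul_le_mul_of_nonneg_right hk' hy.le
      exact ht ⟨by linarith, by linarith⟩
    · rw [hβ0 _ hmem, mul_zero]
  · intro hx t
    exact Finset.sum_nonneg fun k hk =>
      mul_nonneg (hx k (by have := Finset.mem_range.mp hk; omega)) (hβnn _)
  · rw [intervalIntegral.integral_congr (fun t _ => bumpTrain_sq hβ0 hwy x (n + 2) t),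
      intervalIntegral.integral_eq_integral_of_support_subset
        (bumpTrain_support_subset hβ0 hy.le (fun k => x k ^ 2) (n + 2) (S := T) (by push_cast; linarith)),
      integral_bumpTrain_sq_sum hβi _ _ _]
  · show ∫ t in (0:ℝ)..(T - y), (∑ k ∈ range (n + 2), x k * β (t - k * y))
          * (∑ j ∈ range (n + 2), x j * β (t + y - j * y))
        = (∑ k ∈ range (n + 1), x k * x (k + 1)) * ∫ u, β u ^ 2
    rw [intervalIntegral.integral_congr (fun t _ => bumpTrain_mul_shift hβ0 hwy x n t),
      intervalIntegral.integral_eq_integral_of_support_subset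
        (bumpTrain_support_subset hβ0 hy.le (fun k => x k * x (k + 1)) (n + 1) (S := T - y)
          (by push_cast; linarith)),
      integral_bumpTrain_sq_sum hβi _ _ _]

/-- PROVED: the Perron amplitudes `x_k = sin((k+1)π/(n+3))` of the path graph `P_{n+2}` are positive and satisfy
`Σ_{k≤n} x_k x_{k+1} = cos(π/(n+3))·Σ_{k≤n+1} x_k²` (`chain_tight`, d0076f571175, halved). [cite: Mieghem2010, §6.4.1 eq. (6.10)] -/
theorem exists_perron_amplitudes (n : ℕ) :
    ∃ x : ℕ → ℝ, (∀ k, k ≤ n + 1 → 0 < x k) ∧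
      ∑ k ∈ range (n + 1), x k * x (k + 1) = Real.cos (π / ((n:ℝ) + 3)) * ∑ k ∈ range (n + 2), x k ^ 2 := by
  refine ⟨fun k => Real.sin (((k:ℝ) + 1) * (π / ((n:ℝ) + 3))), fun k hk => sin_chain_pos hk, ?_⟩
  have h := chain_tight n
  have h2 : 2 * ∑ k ∈ range (n + 1), Real.sin (((k:ℝ) + 1) * (π / ((n:ℝ) + 3)))
        * Real.sin (((((k + 1 : ℕ)):ℝ) + 1) * (π / ((n:ℝ) + 3)))
      = 2 * Real.cos (π / ((n:ℝ) + 3))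
        * ∑ k ∈ range (n + 2), Real.sin (((k:ℝ) + 1) * (π / ((n:ℝ) + 3))) ^ 2 := by
    simp only [Nat.cast_add, Nat.cast_one]
    convert h using 4 with k
    ring_nf
  show ∑ k ∈ range (n + 1), Real.sin (((k:ℝ) + 1) * (π / ((n:ℝ) + 3)))
        * Real.sin (((((k + 1 : ℕ)):ℝ) + 1) * (π / ((n:ℝ) + 3)))
      = Real.cos (π / ((n:ℝ) + 3)) * ∑ k ∈ range (n + 2), Real.sin (((k:ℝ) + 1) * (π / ((n:ℝ) + 3))) ^ 2
  linarith

/-- PROVED: the ALTERNATING Perron amplitudes `(−1)^k sin((k+1)π/(n+3))` satisfy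
`Σ_{k≤n} x_k x_{k+1} = −cos(π/(n+3))·Σ_{k≤n+1} x_k²` with positive square sum. [cite: Mieghem2010, §6.4.1 eq. (6.10)] -/
theorem exists_alternating_amplitudes (n : ℕ) :
    ∃ x : ℕ → ℝ, 0 < ∑ k ∈ range (n + 2), x k ^ 2 ∧
      ∑ k ∈ range (n + 1), x k * x (k + 1) = -Real.cos (π / ((n:ℝ) + 3)) * ∑ k ∈ range (n + 2), x k ^ 2 := by
  obtain ⟨x0, hxpos, hx0⟩ := exists_perron_amplitudes n
  have hsq : ∀ k : ℕ, ((-1:ℝ) ^ k) ^ 2 = 1 := fun k => by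
    rw [← pow_mul, mul_comm, pow_mul]; norm_num
  have hxsq : ∀ k, ((-1:ℝ) ^ k * x0 k) ^ 2 = x0 k ^ 2 := fun k => by rw [mul_pow, hsq k, one_mul]
  refine ⟨fun k => (-1:ℝ) ^ k * x0 k, ?_, ?_⟩
  · simp only [hxsq]
    exact Finset.sum_pos (fun k hk => pow_pos (hxpos k (by have := Finset.mem_range.mp hk; omega)) 2)
      ⟨0, by simp⟩
  · have hxprod : ∀ k, (-1:ℝ) ^ k * x0 k * ((-1:ℝ) ^ (k + 1) * x0 (k + 1)) = -(x0 k * x0 (k + 1)) :=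
      fun k => by rw [pow_succ]; linear_combination (-(x0 k * x0 (k + 1))) * hsq k
    simp only [hxsq, hxprod, Finset.sum_neg_distrib, hx0]
    ring

/-- **PROVED — BUMP TRAINS ATTAIN THE CHAIN CONSTANT (band form):** for `0 < y` and `(n+1)y < T` there is a
continuous, NONNEGATIVE `f` vanishing off `(0, T)` with `∫_0^T f² > 0` and
`∫_0^{T-y} f(t)f(t+y)dt = cos(π/(n+3))·∫_0^T f²` — a train of `n+2` disjoint bumps at mutual distance `y` with the
Perron amplitudes of `P_{n+2}`.  In the top band `(n+1)y < T ≤ (n+2)y` this is EQUALITY in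
`abs_integral_mul_shift_le_cos` (9bb50f3e143f). [cite: Mieghem2010, §6.4.1 eq. (6.10)] -/
theorem exists_continuous_integral_mul_shift_eq_cos {y T : ℝ} (hy : 0 < y) (n : ℕ)
    (hT : ((n:ℝ) + 1) * y < T) :
    ∃ f : ℝ → ℝ, Continuous f ∧ (∀ t, 0 ≤ f t) ∧ (∀ t, t ∉ Set.Ioo 0 T → f t = 0) ∧
      0 < ∫ t in (0:ℝ)..T, f t ^ 2 ∧
      ∫ t in (0:ℝ)..(T - y), f t * f (t + y) = Real.cos (π / ((n:ℝ) + 3)) * ∫ t in (0:ℝ)..T, f t ^ 2 := by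
  obtain ⟨x, hxpos, hx⟩ := exists_perron_amplitudes n
  obtain ⟨f, hf, hsupp, hnn, B, hB, hE, hC⟩ := exists_bumpTrain_integrals hy n hT x
  have hX : 0 < ∑ k ∈ range (n + 2), x k ^ 2 :=
    Finset.sum_pos (fun k hk => pow_pos (hxpos k (by have := Finset.mem_range.mp hk; omega)) 2) ⟨0, by simp⟩
  refine ⟨f, hf, hnn fun k hk => (hxpos k hk).le, hsupp, ?_, ?_⟩
  · rw [hE]; exact mul_pos hX hB
  · rw [hC, hE, hx]; ring

/-- PROVED (top band): for `0 < y < T`, `n = ⌈T/y⌉₊ − 2` has `(n+1)y < T` (positive slack) and `n+3 = ⌈T/y⌉₊+1`. [folklore] -/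
theorem exists_top_band {y T : ℝ} (hy : 0 < y) (hyT : y < T) :
    ∃ n : ℕ, ((n:ℝ) + 1) * y < T ∧ (n:ℝ) + 3 = (((⌈T / y⌉₊ : ℕ) : ℝ)) + 1 := by
  set x : ℝ := T / y with hx
  have hxy : x * y = T := by rw [hx]; exact div_mul_cancel₀ T (ne_of_gt hy)
  have hx1 : 1 < x := by rw [hx, lt_div_iff₀ hy]; linarith
  set M : ℕ := ⌈x⌉₊ with hM
  have hxM : x ≤ (M:ℝ) := Nat.le_ceil x
  have hMx : (M:ℝ) < x + 1 := Nat.ceil_lt_add_one (by linarith)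
  have hM2 : 2 ≤ M := by
    have : 1 < M := by exact_mod_cast (lt_of_lt_of_le hx1 hxM : (1:ℝ) < (M:ℝ))
    omega
  obtain ⟨n, hn⟩ : ∃ n : ℕ, M = n + 2 := ⟨M - 2, by omega⟩
  have hn' : ((n:ℝ) + 2) = (M:ℝ) := by rw [hn]; push_cast; ring
  refine ⟨n, ?_, by linarith [hn']⟩
  have h1 : (M:ℝ) * y < (x + 1) * y := mul_lt_mul_of_pos_right hMx hy
  have e : (n:ℝ) + 1 = (M:ℝ) - 1 := by linarith [hn']
  rw [e]; linarith [h1, hxy]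

/-- **PROVED — THE UNIVERSAL CEILING IS ATTAINED (sharp form):** for every `0 < y < T` there is a continuous,
nonnegative `f` vanishing off `(0, T)` with `∫_0^T f² > 0` and
`∫_0^{T-y} f(t)f(t+y)dt = cos(π/(⌈T/y⌉₊+1))·∫_0^T f²` — EQUALITY in `abs_integral_mul_shift_le_cos_ceil`
(9bb50f3e143f): the constant `cos(π/(⌈T/y⌉₊+1))` is the MAXIMUM of the normalised shifted correlation over
continuous `f ≢ 0` on `[0, T]`. [cite: Mieghem2010, §6.4.1 eq. (6.10)] -/
theorem exists_continuous_integral_mul_shift_eq_cos_ceil {y T : ℝ} (hy : 0 < y) (hyT : y < T) :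
    ∃ f : ℝ → ℝ, Continuous f ∧ (∀ t, 0 ≤ f t) ∧ (∀ t, t ∉ Set.Ioo 0 T → f t = 0) ∧
      0 < ∫ t in (0:ℝ)..T, f t ^ 2 ∧
      ∫ t in (0:ℝ)..(T - y), f t * f (t + y)
        = Real.cos (π / (((⌈T / y⌉₊ : ℕ) : ℝ) + 1)) * ∫ t in (0:ℝ)..T, f t ^ 2 := by
  obtain ⟨n, hT1, e3⟩ := exists_top_band hy hyT
  have h := exists_continuous_integral_mul_shift_eq_cos hy n hT1
  rwa [e3] at h

/-- **PROVED — THE NEGATIVE CEILING IS ATTAINED TOO (band form):** for `0 < y` and `(n+1)y < T` there is a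
continuous `f` vanishing off `(0, T)` with `∫_0^T f² > 0` and `∫_0^{T-y} f f(·+y) = −cos(π/(n+3))·∫_0^T f²`
(the same bump train with ALTERNATING Perron amplitudes). [cite: Mieghem2010, §6.4.1 eq. (6.10)] -/
theorem exists_continuous_integral_mul_shift_eq_neg_cos {y T : ℝ} (hy : 0 < y) (n : ℕ)
    (hT : ((n:ℝ) + 1) * y < T) :
    ∃ f : ℝ → ℝ, Continuous f ∧ (∀ t, t ∉ Set.Ioo 0 T → f t = 0) ∧
      0 < ∫ t in (0:ℝ)..T, f t ^ 2 ∧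
      ∫ t in (0:ℝ)..(T - y), f t * f (t + y) = -Real.cos (π / ((n:ℝ) + 3)) * ∫ t in (0:ℝ)..T, f t ^ 2 := by
  obtain ⟨x, hX, hx⟩ := exists_alternating_amplitudes n
  obtain ⟨f, hf, hsupp, -, B, hB, hE, hC⟩ := exists_bumpTrain_integrals hy n hT x
  refine ⟨f, hf, hsupp, ?_, ?_⟩
  · rw [hE]; exact mul_pos hX hB
  · rw [hC, hE, hx]; ring

/-- **PROVED — THE NEGATIVE CEILING IS ATTAINED (sharp form):** for every `0 < y < T` there is a continuous `f`
vanishing off `(0, T)` with `∫_0^T f² > 0` and `∫_0^{T-y} f f(·+y) = −cos(π/(⌈T/y⌉₊+1))·∫_0^T f²`.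
[cite: Mieghem2010, §6.4.1 eq. (6.10)] -/
theorem exists_continuous_integral_mul_shift_eq_neg_cos_ceil {y T : ℝ} (hy : 0 < y) (hyT : y < T) :
    ∃ f : ℝ → ℝ, Continuous f ∧ (∀ t, t ∉ Set.Ioo 0 T → f t = 0) ∧
      0 < ∫ t in (0:ℝ)..T, f t ^ 2 ∧
      ∫ t in (0:ℝ)..(T - y), f t * f (t + y)
        = -Real.cos (π / (((⌈T / y⌉₊ : ℕ) : ℝ) + 1)) * ∫ t in (0:ℝ)..T, f t ^ 2 := by
  obtain ⟨n, hT1, e3⟩ := exists_top_band hy hyT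
  have h := exists_continuous_integral_mul_shift_eq_neg_cos hy n hT1
  rwa [e3] at h

/-! ## §3 Optimality of the universal constant -/

/-- **PROVED — OPTIMALITY (upper side):** if `∫_0^{T-y} f f(·+y) ≤ c·∫_0^T f²` for every continuous nonnegative `f`,
then `cos(π/(⌈T/y⌉₊+1)) ≤ c` (`0 < y < T`): the ceiling of 9bb50f3e143f cannot be lowered. [cite: Mieghem2010, §6.4.1 eq. (6.10)] -/
theorem cos_ceil_le_of_forall_integral_mul_shift_le {y T c : ℝ} (hy : 0 < y) (hyT : y < T)
    (h : ∀ f : ℝ → ℝ, Continuous f → (∀ t, 0 ≤ f t) →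
      ∫ t in (0:ℝ)..(T - y), f t * f (t + y) ≤ c * ∫ t in (0:ℝ)..T, f t ^ 2) :
    Real.cos (π / (((⌈T / y⌉₊ : ℕ) : ℝ) + 1)) ≤ c := by
  obtain ⟨f, hf, hnn, -, hE, hcorr⟩ := exists_continuous_integral_mul_shift_eq_cos_ceil hy hyT
  have h1 := h f hf hnn
  rw [hcorr] at h1
  exact le_of_mul_le_mul_right h1 hE

/-- **PROVED — OPTIMALITY (lower side):** if `c·∫_0^T f² ≤ ∫_0^{T-y} f f(·+y)` for every continuous `f`, then
`c ≤ −cos(π/(⌈T/y⌉₊+1))` (`0 < y < T`). [cite: Mieghem2010, §6.4.1 eq. (6.10)] -/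
theorem le_neg_cos_ceil_of_forall_le_integral_mul_shift {y T c : ℝ} (hy : 0 < y) (hyT : y < T)
    (h : ∀ f : ℝ → ℝ, Continuous f →
      c * ∫ t in (0:ℝ)..T, f t ^ 2 ≤ ∫ t in (0:ℝ)..(T - y), f t * f (t + y)) :
    c ≤ -Real.cos (π / (((⌈T / y⌉₊ : ℕ) : ℝ) + 1)) := by
  obtain ⟨f, hf, -, hE, hcorr⟩ := exists_continuous_integral_mul_shift_eq_neg_cos_ceil hy hyT
  have h1 := h f hf
  rw [hcorr] at h1
  exact le_of_mul_le_mul_right h1 hE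

/-- **PROVED — THE EXACT UNIVERSAL CONSTANT:** for `0 < y < T`, `c` bounds `|∫_0^{T-y} f f(·+y)| ≤ c·∫_0^T f²`
for every continuous `f` if and only if `cos(π/(⌈T/y⌉₊+1)) ≤ c` (the `if` direction is 9bb50f3e143f).
[cite: Mieghem2010, §6.4.1 eq. (6.10)] -/
theorem forall_abs_integral_mul_shift_le_iff {y T c : ℝ} (hy : 0 < y) (hyT : y < T) :
    (∀ f : ℝ → ℝ, Continuous f →
        |∫ t in (0:ℝ)..(T - y), f t * f (t + y)| ≤ c * ∫ t in (0:ℝ)..T, f t ^ 2)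
      ↔ Real.cos (π / (((⌈T / y⌉₊ : ℕ) : ℝ) + 1)) ≤ c := by
  constructor
  · intro h
    exact cos_ceil_le_of_forall_integral_mul_shift_le hy hyT
      fun f hf _ => le_trans (le_abs_self _) (h f hf)
  · intro hc f hf
    have h0 := abs_integral_mul_shift_le_cos_ceil hf hy hyT
    have hsq : 0 ≤ ∫ t in (0:ℝ)..T, f t ^ 2 :=
      intervalIntegral.integral_nonneg (by linarith) fun t _ => sq_nonneg _
    exact le_trans h0 (mul_le_mul_of_nonneg_right hc hsq)

/-! ## §4 The window form -/

/-- **PROVED — ATTAINMENT ON THE SYMMETRIC WINDOW:** for `0 < y < L` there is a continuous, nonnegative `f` with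
`∫_{-L/2}^{L/2} f² > 0` and `∫_{-L/2}^{L/2-y} f(x)f(x+y)dx = cos(π/(⌈L/y⌉₊+1))·∫_{-L/2}^{L/2} f²` — equality in
`abs_integral_window_shift_le_cos_ceil` (9bb50f3e143f): the Galerkin ceilings `|A^±_v(y)| ≤ cos(π/(⌈L/y⌉₊+1))‖v‖²` carry
the best WINDOW-LEVEL constant (how close degree-`N` vectors come is DATA, not claimed). [cite: Mieghem2010, §6.4.1 eq. (6.10)] -/
theorem exists_continuous_integral_window_shift_eq_cos_ceil {y L : ℝ} (hy : 0 < y) (hyL : y < L) :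
    ∃ f : ℝ → ℝ, Continuous f ∧ (∀ x, 0 ≤ f x) ∧
      0 < ∫ x in (-(L / 2))..(L / 2), f x ^ 2 ∧
      ∫ x in (-(L / 2))..(L / 2 - y), f x * f (x + y)
        = Real.cos (π / (((⌈L / y⌉₊ : ℕ) : ℝ) + 1)) * ∫ x in (-(L / 2))..(L / 2), f x ^ 2 := by
  obtain ⟨g, hg, hnn, -, hE, hcorr⟩ := exists_continuous_integral_mul_shift_eq_cos_ceil hy hyL
  refine ⟨fun x => g (x + L / 2), hg.comp (continuous_id.add continuous_const), fun x => hnn _, ?_, ?_⟩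
  · have h2 := integral_window_sq_eq (fun x => g (x + L / 2)) L
    simp only [sub_add_cancel] at h2
    rw [h2]
    exact hE
  · have h1 := integral_window_shift_eq (fun x => g (x + L / 2)) L y
    have h2 := integral_window_sq_eq (fun x => g (x + L / 2)) L
    simp only [sub_add_cancel] at h1 h2
    rw [h1, h2]
    exact hcorr

end Summit.RiemannHypothesis.RiemannHypothesis.Theorems.PfPersistence

end
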